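import Mathlib
import HarnessLib
import Summits.KontsevichZagierPeriods.KontsevichZagierPeriods.Theorems.LinRedNormalFormArrangementNormalFormStubIntegrateOutPoly

/-!
# `stub_integrateOut` (crux `ArrangementNormalForm`, line `janus-bands`)

`Gᵢ b k → closure (JD (b + k))`: a rebased Janus band representation whose distinguished base
coordinate `y` carries `(y − ℓ₁(x'))^{n₁}` (`n₂ = 0`) or a pole `(y − ℓ₂(x'))^{-n₂}` of order
`n₂ ≥ 2` (`n₁ = 0`), with `y`-free fibre letters and fibre bounds `y`-free or `y` itself, is
congruent modulo the KZ moves to a `ℤ`-combination of Janus band representations of total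
dimension `b + k`:

1. relabel the coordinates so that `y` is last (rule 2) and PROMOTE all fibres to base
   coordinates: in the flat coordinates `(x', t, y)` the domain is a rational polytope in
   `(x', t)` (`ZRG`: `y`-free rows and fibre bounds other than `y`) times the `y`-interval
   between the lower bounds `LWG` (rows with positive `y`-coefficient solved for `y`, fibres
   whose upper bound is `y`) and the upper bounds `UPG` (`mem_flat_iff`), and the integrand is
   `ratJ(x', t) · (y-factor)` where the fibre letters `tᵢ − cᵢ(x')` have joined the affine
   denominators (`integrand_flat`);
2. integrate `y` out (`flat_poly` / `flat_pole`, parts 3–4): every piece lands in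
   `JJ (b + k) 0 ⊆ JD (b + k)` — ONE Newton–Leibniz move per piece, the output never split.
-/

noncomputable section

open Set MeasureTheory
open Literature.NumberTheory.Transcendental
open Literature.ModelTheory.ExponentialFields

namespace Summit.KontsevichZagierPeriods.ArrangementNormalForm.JanusBands

namespace IntegrateOut

/-! ### The `Gᵢ b k` data in flat band coordinates: all fibres become base coordinates -/

variable {b k : ℕ}

/-- The domain of a band-coordinate representation is bounded if the original one is.
[folklore] -/
theorem isBounded_reindex {n N : ℕ} {D : Set (Fin n → ℝ)} (hD : Bornology.IsBounded D)
    (e : Fin n ≃ Fin N) : Bornology.IsBounded {w : Fin N → ℝ | (fun i => w (e i)) ∈ D} := by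
  obtain ⟨C, hC⟩ := isBounded_iff_forall_norm_le.mp hD
  refine isBounded_iff_forall_norm_le.mpr ⟨C, fun w hw => le_trans ?_ (hC _ hw)⟩
  refine (pi_norm_le_iff_of_nonneg (norm_nonneg _)).mpr fun j => ?_
  simpa using norm_le_pi_norm (fun i => w (e i)) (e.symm j)

/-- A fibre bound of a `Gᵢ b k` representation as a datum on the flat coordinates `(x', t)`:
`some f` for another fibre (its coordinate form) or a `y`-free affine function of `x'`
(padded), `none` for the bound "`y` itself". [folklore] -/
def bform (b k : ℕ) (u : Fin k ⊕ ((Fin (b + 1) → ℚ) × ℚ)) : Option ((Fin (b + k) → ℚ) × ℚ) :=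
  Sum.elim (fun j => some (crd b j))
    (fun c => if c = (Pi.single (Fin.last b) 1, 0) then none else some (pad k (restr c))) u

/-- The value of a fibre bound in flat band coordinates. [folklore] -/
theorem bform_val (u : Fin k ⊕ ((Fin (b + 1) → ℚ) × ℚ))
    (hu : ∀ c, u = Sum.inr c → c.1 (Fin.last b) = 0 ∨ c = (Pi.single (Fin.last b) 1, 0))
    (w : Fin (b + k + 1) → ℝ) :
    Sum.elim (fun j => w (eqv b k (Fin.natAdd (b + 1) j)))
        (fun c => ∑ i', (c.1 i' : ℝ) * w (eqv b k (Fin.castAdd k i')) + (c.2 : ℝ)) u =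
      (bform b k u).elim (w (Fin.last (b + k))) (fun f => ev f (Fin.init w)) := by
  rcases u with j | c
  · simp [bform, Fin.init]
  · rcases hu c rfl with h0 | rfl
    · have hne : c ≠ (Pi.single (Fin.last b) 1, 0) := fun h => by
        rw [h] at h0
        simp at h0
      have := ev_of_last_eq_zero c h0 (fun i => w (eqv b k (Fin.castAdd k i)))
      simp only [eqv_x] at this
      simp only [bform, Sum.elim_inr, if_neg hne, Option.elim, ev_pad]
      exact this
    · simp [bform, ev, Fin.sum_univ_castSucc, Fin.castSucc_ne_last]

/-- Comparison with an optional bound, unfolded (`none` = the coordinate `y`). [folklore] -/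
theorem elim_lt_iff {F : Type*} (o : Option F) (d : F) (y t : ℝ) (g : F → ℝ) :
    o.elim y g < t ↔ (o.isSome → g (o.getD d) < t) ∧ (o = none → y < t) := by
  cases o <;> simp

/-- Comparison with an optional bound, unfolded (`none` = the coordinate `y`). [folklore] -/
theorem lt_elim_iff {F : Type*} (o : Option F) (d : F) (y t : ℝ) (g : F → ℝ) :
    t < o.elim y g ↔ (o.isSome → t < g (o.getD d)) ∧ (o = none → t < y) := by
  cases o <;> simp

variable {m m' : ℕ}

/-- The `y`-free rows of the flat base polytope: the `y`-free base rows and the fibre bounds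
other than `y`. [folklore] -/
def ZRG (M : Fin m' → (Fin (b + 1) → ℚ) × ℚ) (lo hi : Fin k → Fin k ⊕ ((Fin (b + 1) → ℚ) × ℚ)) :
    Finset ((Fin (b + k) → ℚ) × ℚ) :=
  (Finset.univ.filter fun j => (M j).1 (Fin.last b) = 0).image (fun j => pad k (restr (M j))) ∪
  ((Finset.univ.filter fun i => (bform b k (lo i)).isSome).image
      (fun i => crd b i - (bform b k (lo i)).getD 0) ∪
    (Finset.univ.filter fun i => (bform b k (hi i)).isSome).image
      (fun i => (bform b k (hi i)).getD 0 - crd b i))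

/-- The lower bounds of `y` in flat coordinates: base rows with positive `y`-coefficient solved
for `y`, and the fibres whose upper bound is `y`. [folklore] -/
def LWG (M : Fin m' → (Fin (b + 1) → ℚ) × ℚ) (hi : Fin k → Fin k ⊕ ((Fin (b + 1) → ℚ) × ℚ)) :
    Finset ((Fin (b + k) → ℚ) × ℚ) :=
  (Finset.univ.filter fun j => 0 < (M j).1 (Fin.last b)).image (fun j => pad k (nrm (M j))) ∪
  (Finset.univ.filter fun i => bform b k (hi i) = none).image (crd b)

/-- The upper bounds of `y` in flat coordinates: base rows with negative `y`-coefficient solved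
for `y`, and the fibres whose lower bound is `y`. [folklore] -/
def UPG (M : Fin m' → (Fin (b + 1) → ℚ) × ℚ) (lo : Fin k → Fin k ⊕ ((Fin (b + 1) → ℚ) × ℚ)) :
    Finset ((Fin (b + k) → ℚ) × ℚ) :=
  (Finset.univ.filter fun j => (M j).1 (Fin.last b) < 0).image (fun j => pad k (nrm (M j))) ∪
  (Finset.univ.filter fun i => bform b k (lo i) = none).image (crd b)

/-- **The `Gᵢ b k` domain in flat band coordinates**: after the relabelling `eqv`, a point `w`
(last coordinate `y`) lies in the domain iff `(x', t) = init w` lies in the polytope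
`poly (ZRG M lo hi)` and `y` lies strictly between the lower bounds `LWG` and the upper bounds
`UPG`. [folklore] -/
theorem mem_flat_iff (M : Fin m' → (Fin (b + 1) → ℚ) × ℚ)
    (lo hi : Fin k → Fin k ⊕ ((Fin (b + 1) → ℚ) × ℚ))
    (hlh : ∀ i c, (lo i = Sum.inr c ∨ hi i = Sum.inr c) →
      (c.1 (Fin.last b) = 0 ∨ c = (Pi.single (Fin.last b) 1, 0)))
    (w : Fin (b + k + 1) → ℝ) :
    (fun i => w (eqv b k i)) ∈ {z : Fin (b + 1 + k) → ℝ |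
      (∀ j, 0 < ∑ i, ((M j).1 i : ℝ) * z (Fin.castAdd k i) + ((M j).2 : ℝ)) ∧
      ∀ i, Sum.elim (fun j => z (Fin.natAdd (b + 1) j))
          (fun c => ∑ i', (c.1 i' : ℝ) * z (Fin.castAdd k i') + (c.2 : ℝ)) (lo i) <
          z (Fin.natAdd (b + 1) i) ∧
        z (Fin.natAdd (b + 1) i) < Sum.elim (fun j => z (Fin.natAdd (b + 1) j))
          (fun c => ∑ i', (c.1 i' : ℝ) * z (Fin.castAdd k i') + (c.2 : ℝ)) (hi i)} ↔
    ((Fin.init w : Fin (b + k) → ℝ) ∈ poly (b + k) (ZRG M lo hi) ∧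
      (∀ P ∈ LWG M hi, ev P (Fin.init w) < w (Fin.last (b + k))) ∧
      ∀ S ∈ UPG M lo, w (Fin.last (b + k)) < ev S (Fin.init w)) := by
  have hev : ∀ j, (∑ i, ((M j).1 i : ℝ) * w (eqv b k (Fin.castAdd k i)) + ((M j).2 : ℝ)) =
      ev (M j) (fun i => w (eqv b k (Fin.castAdd k i))) := fun j => rfl
  have hrow : ∀ j, 0 < ev (M j) (fun i => w (eqv b k (Fin.castAdd k i))) ↔
      (((M j).1 (Fin.last b) = 0 →
          0 < ev (restr (M j)) (fun i => w (Fin.castSucc (Fin.castAdd k i)))) ∧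
       (0 < (M j).1 (Fin.last b) →
          ev (nrm (M j)) (fun i => w (Fin.castSucc (Fin.castAdd k i))) < w (Fin.last (b + k))) ∧
       ((M j).1 (Fin.last b) < 0 →
          w (Fin.last (b + k)) <
            ev (nrm (M j)) (fun i => w (Fin.castSucc (Fin.castAdd k i))))) := by
    intro j
    have := row_iff (M j) (fun i => w (eqv b k (Fin.castAdd k i)))
    simp only [eqv_x, eqv_y] at this
    exact this
  have hlo : ∀ i, Sum.elim (fun j => w (eqv b k (Fin.natAdd (b + 1) j)))
      (fun c => ∑ i', (c.1 i' : ℝ) * w (eqv b k (Fin.castAdd k i')) + (c.2 : ℝ)) (lo i) =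
      (bform b k (lo i)).elim (w (Fin.last (b + k))) (fun f => ev f (Fin.init w)) :=
    fun i => bform_val (lo i) (fun c hc => hlh i c (Or.inl hc)) w
  have hhi : ∀ i, Sum.elim (fun j => w (eqv b k (Fin.natAdd (b + 1) j)))
      (fun c => ∑ i', (c.1 i' : ℝ) * w (eqv b k (Fin.castAdd k i')) + (c.2 : ℝ)) (hi i) =
      (bform b k (hi i)).elim (w (Fin.last (b + k))) (fun f => ev f (Fin.init w)) :=
    fun i => bform_val (hi i) (fun c hc => hlh i c (Or.inr hc)) w
  simp only [mem_setOf_eq]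
  simp only [hlo, hhi, hev]
  simp only [hrow, eqv_t, elim_lt_iff _ (0 : (Fin (b + k) → ℚ) × ℚ),
    lt_elim_iff _ (0 : (Fin (b + k) → ℚ) × ℚ)]
  simp only [forall_and, poly, ZRG, LWG, UPG, Finset.forall_mem_union, Finset.forall_mem_image,
    Finset.mem_filter, Finset.mem_univ, true_and, ev_sub, sub_pos, ev_crd, ev_pad, Fin.init,
    mem_setOf_eq]
  tauto

/-- The flat denominator list: `L` (padded) followed by the fibre letters `tᵢ − cᵢ(x')`
(the constant `1` for a letter-free fibre). [folklore] -/
def Lflat (k : ℕ) (L : Fin m → (Fin b → ℚ) × ℚ) (a : Fin k → Option ((Fin (b + 1) → ℚ) × ℚ)) :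
    Fin (m + k) → (Fin (b + k) → ℚ) × ℚ :=
  Fin.append (fun j => pad k (L j))
    (fun i => (a i).elim (0, 1) (fun c => crd b i - pad k (restr c)))

/-- The flat exponent list: `e` followed by `1`s. [folklore] -/
def eflat (k : ℕ) (e : Fin m → ℕ) : Fin (m + k) → ℕ := Fin.append e (fun _ => 1)

/-- **The `Gᵢ b k` integrand in flat band coordinates** (letters `y`-free): the fibre letters
join the denominator of the rational factor. [folklore] -/
theorem integrand_flat (L : Fin m → (Fin b → ℚ) × ℚ) (e : Fin m → ℕ)
    (p : MvPolynomial (Fin b) ℚ) (ℓ₁ ℓ₂ : (Fin b → ℚ) × ℚ) (n₁ n₂ : ℕ)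
    (a : Fin k → Option ((Fin (b + 1) → ℚ) × ℚ)) (ha : ∀ i c, a i = some c → c.1 (Fin.last b) = 0)
    (w : Fin (b + k + 1) → ℝ) :
    (fun z : Fin (b + 1 + k) → ℝ =>
      MvPolynomial.aeval (fun i => z (Fin.castAdd k (Fin.castSucc i))) p /
        (∏ j, (∑ i, ((L j).1 i : ℝ) * z (Fin.castAdd k (Fin.castSucc i)) + ((L j).2 : ℝ)) ^ e j) *
      ((z (Fin.castAdd k (Fin.last b)) -
          (∑ i, (ℓ₁.1 i : ℝ) * z (Fin.castAdd k (Fin.castSucc i)) + (ℓ₁.2 : ℝ))) ^ n₁ /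
        (z (Fin.castAdd k (Fin.last b)) -
          (∑ i, (ℓ₂.1 i : ℝ) * z (Fin.castAdd k (Fin.castSucc i)) + (ℓ₂.2 : ℝ))) ^ n₂) *
      ∏ i, (a i).elim 1 (fun c => 1 / (z (Fin.natAdd (b + 1) i) -
        (∑ i', (c.1 i' : ℝ) * z (Fin.castAdd k i') + (c.2 : ℝ))))) (fun i => w (eqv b k i)) =
    ratJ (b + k) (m + k) (Lflat k L a) (eflat k e) (MvPolynomial.rename (Fin.castAdd k) p)
        (Fin.init w) *
      ((w (Fin.last (b + k)) - ev (pad k ℓ₁) (Fin.init w)) ^ n₁ /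
        (w (Fin.last (b + k)) - ev (pad k ℓ₂) (Fin.init w)) ^ n₂) := by
  have hprod : ∀ i, (a i).elim (1 : ℝ) (fun c => 1 / (w (eqv b k (Fin.natAdd (b + 1) i)) -
      (∑ i', (c.1 i' : ℝ) * w (eqv b k (Fin.castAdd k i')) + (c.2 : ℝ)))) =
      (ev ((a i).elim ((0 : Fin (b + k) → ℚ), (1 : ℚ)) (fun c => crd b i - pad k (restr c)))
        (Fin.init w))⁻¹ := by
    intro i
    rcases h : a i with _ | c
    · simp [ev]
    · have := ev_of_last_eq_zero c (ha i c h) (fun i' => w (eqv b k (Fin.castAdd k i')))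
      simp only [eqv_x] at this
      simp only [Option.elim, eqv_t, ev_sub, ev_crd, ev_pad, one_div]
      change (_ - ev c (fun i' => w (eqv b k (Fin.castAdd k i'))))⁻¹ = _
      rw [this]
      rfl
  simp only [hprod, ratJ, Lflat, eflat, Fin.prod_univ_add, Fin.append_left, Fin.append_right,
    ev_pad, MvPolynomial.aeval_rename, eqv_x, eqv_y, pow_one, Finset.prod_inv_distrib]
  simp only [ev, Function.comp_def, Fin.init]
  ring

end IntegrateOut

open IntegrateOut in
/-- **stub_integrateOut** (`Gᵢ b k → closure (JD (b + k))`, line `janus-bands`). The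
distinguished base coordinate `y` carries the polynomial factor `(y − ℓ₁(x'))^{n₁}` (`n₂ = 0`)
or a pole `(y − ℓ₂(x'))^{-n₂}` of order `n₂ ≥ 2` (`n₁ = 0`); fibre letters are `y`-free and
fibre bounds are `y`-free or `y` itself. Relabel the coordinates so that `y` is last (rule 2)
and PROMOTE every fibre to a base coordinate: in the flat coordinates `(x', t, y)` the domain is
a rational polytope in `(x', t)` times the `y`-interval between finitely many affine lower
bounds (base rows solved for `y`, fibres attached to `y` from below) and upper bounds, and the
integrand is a rational function of `(x', t)` with affine denominators (the letters
`tᵢ − cᵢ(x')` join the denominator) times the `y`-factor. Dissect by the largest lower / smallest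
upper bound of `y` (and the side of the pole), rule 1a, and integrate `y` out on each piece by
ONE Newton–Leibniz move with the polynomial / rational primitive (rule 3, never splitting the
output): every piece lands in `JJ (b + k) 0 ⊆ JD (b + k)`.
[Kontsevich–Zagier 2001, §1.2, rules (1)–(3)] -/
theorem stub_integrateOut (JJ : ℕ → ℕ → Set KZ.FormalRep) (Gᵢ : ℕ → ℕ → Set KZ.FormalRep) (JD : ℕ → Set KZ.FormalRep) (hJJ : ∀ b k, JJ b k = {w : KZ.FormalRep | ∃ (m m' : ℕ) (s : KZ.IntegralRep (b + k)) (M : Fin m' → (Fin b → ℚ) × ℚ) (L : Fin m → (Fin b → ℚ) × ℚ) (e : Fin m → ℕ) (p : MvPolynomial (Fin b) ℚ) (a : Fin k → Option ((Fin b → ℚ) × ℚ)) (lo hi : Fin k → Fin k ⊕ ((Fin b → ℚ) × ℚ)), Bornology.IsBounded s.domain ∧ s.domain = {z | (∀ j, 0 < ∑ i, ((M j).1 i : ℝ) * z (Fin.castAdd k i) + ((M j).2 : ℝ)) ∧ ∀ i, Sum.elim (fun j => z (Fin.natAdd b j)) (fun c => ∑ i', (c.1 i' : ℝ) * z (Fin.castAdd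 k i') + (c.2 : ℝ)) (lo i) < z (Fin.natAdd b i) ∧ z (Fin.natAdd b i) < Sum.elim (fun j => z (Fin.natAdd b j)) (fun c => ∑ i', (c.1 i' : ℝ) * z (Fin.castAdd k i') + (c.2 : ℝ)) (hi i)} ∧ EqOn s.integrand (fun z => MvPolynomial.aeval (fun i => z (Fin.castAdd k i)) p / (∏ j, (∑ i, ((L j).1 i : ℝ) * z (Fin.castAdd k i) + ((L j).2 : ℝ)) ^ e j) * ∏ i, (a i).elim 1 (fun c => 1 / (z (Fin.natAdd b i) - (∑ i', (c.1 i' : ℝ) * z (Fin.castAdd k i') + (c.2 : ℝ))))) s.domain ∧ w = KZ.of s}) (hGᵢ : ∀ b k, Gᵢ b k = {w : KZ.FormalRep | ∃ (m m' n₁ n₂ : ℕ) (s : KZ.IntegralRep (b + 1 + k)) (M : Fin m' → (Fin (b + 1) → ℚ) × ℚ) (L : Fin m → (Fin b → ℚ) × ℚ) (e : Fin m → ℕ) (p : MvPolynomial (Fin b) ℚ) (ℓ₁ ℓ₂ : (Fin b → ℚ) × ℚ) (a : Fin k → Option ((Fin (b + 1) → ℚ) × ℚ)) (lo hi : Fin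 k → Fin k ⊕ ((Fin (b + 1) → ℚ) × ℚ)), (n₁ = 0 ∨ n₂ = 0) ∧ n₂ ≠ 1 ∧ (∀ i c, a i = some c → c.1 (Fin.last b) = 0) ∧ (∀ i c, (lo i = Sum.inr c ∨ hi i = Sum.inr c) → (c.1 (Fin.last b) = 0 ∨ c = (Pi.single (Fin.last b) 1, 0))) ∧ Bornology.IsBounded s.domain ∧ s.domain = {z | (∀ j, 0 < ∑ i, ((M j).1 i : ℝ) * z (Fin.castAdd k i) + ((M j).2 : ℝ)) ∧ ∀ i, Sum.elim (fun j => z (Fin.natAdd (b + 1) j)) (fun c => ∑ i', (c.1 i' : ℝ) * z (Fin.castAdd k i') + (c.2 : ℝ)) (lo i) < z (Fin.natAdd (b + 1) i) ∧ z (Fin.natAdd (b + 1) i) < Sum.elim (fun j => z (Fin.natAdd (b + 1) j)) (fun c => ∑ i', (c.1 i' : ℝ) * z (Fin.castAdd k i') + (c.2 : ℝ)) (hi i)} ∧ EqOn s.integrand (fun z => MvPolynomial.aeval (fun i => z (Fin.castAdd k (Fin.castSucc i))) p / (∏ j, (∑ i, ((L j).1 i : ℝ) * z (Fin.castAdd k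 (Fin.castSucc i)) + ((L j).2 : ℝ)) ^ e j) * ((z (Fin.castAdd k (Fin.last b)) - (∑ i, (ℓ₁.1 i : ℝ) * z (Fin.castAdd k (Fin.castSucc i)) + (ℓ₁.2 : ℝ))) ^ n₁ / (z (Fin.castAdd k (Fin.last b)) - (∑ i, (ℓ₂.1 i : ℝ) * z (Fin.castAdd k (Fin.castSucc i)) + (ℓ₂.2 : ℝ))) ^ n₂) * ∏ i, (a i).elim 1 (fun c => 1 / (z (Fin.natAdd (b + 1) i) - (∑ i', (c.1 i' : ℝ) * z (Fin.castAdd k i') + (c.2 : ℝ))))) s.domain ∧ w = KZ.of s}) (hJD : ∀ N, JD N = {w : KZ.FormalRep | ∃ b' k', b' + k' = N ∧ w ∈ JJ b' k'}) (b k : ℕ) : ∀ x ∈ Gᵢ b k, ∃ c ∈ AddSubgroup.closure (JD (b + k)), x - c ∈ KZ.relations := by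
  intro x hx
  rw [hGᵢ] at hx
  obtain ⟨m, m', n₁, n₂, s, M, L, e, p, ℓ₁, ℓ₂, a, lo, hi, h12, hn1, ha, hlh, hbd, hdom, hint,
    rfl⟩ := hx
  set r₀ := s.reindex (eqv b k) with hr₀
  have h₀ : KZ.of s - KZ.of r₀ ∈ KZ.relations := of_sub_of_reindex_mem_relations s (eqv b k)
  have hmem : ∀ w, w ∈ r₀.domain ↔ ((Fin.init w : Fin (b + k) → ℝ) ∈ poly (b + k) (ZRG M lo hi) ∧
      (∀ P ∈ LWG M hi, ev P (Fin.init w) < w (Fin.last (b + k))) ∧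
      ∀ S ∈ UPG M lo, w (Fin.last (b + k)) < ev S (Fin.init w)) := by
    intro w
    rw [hr₀, KZ.IntegralRep.reindex_domain, mem_setOf_eq, hdom]
    exact mem_flat_iff M lo hi hlh w
  have hr₀b : Bornology.IsBounded r₀.domain := by
    rw [hr₀, KZ.IntegralRep.reindex_domain]
    exact isBounded_reindex hbd (eqv b k)
  have hr₀i : ∀ w ∈ r₀.domain, r₀.integrand w =
      ratJ (b + k) (m + k) (Lflat k L a) (eflat k e) (MvPolynomial.rename (Fin.castAdd k) p)
        (Fin.init w) *
      ((w (Fin.last (b + k)) - ev (pad k ℓ₁) (Fin.init w)) ^ n₁ /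
        (w (Fin.last (b + k)) - ev (pad k ℓ₂) (Fin.init w)) ^ n₂) := by
    intro w hw
    have hw' : (fun i => w (eqv b k i)) ∈ s.domain := by
      rw [hr₀, KZ.IntegralRep.reindex_domain] at hw
      exact hw
    rw [hr₀, KZ.IntegralRep.reindex_integrand]
    simp only
    rw [hint hw']
    exact integrand_flat L e p ℓ₁ ℓ₂ n₁ n₂ a ha w
  have hsub : JJ0 (b + k) ⊆ JD (b + k) := fun w hw => by
    rw [hJD]
    exact ⟨b + k, 0, rfl, by rw [hJJ]; exact hw⟩
  have key : ∃ c ∈ AddSubgroup.closure (JJ0 (b + k)), KZ.of r₀ - c ∈ KZ.relations := by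
    rcases n₂ with _ | _ | n'
    · exact flat_poly r₀ (ZRG M lo hi) (LWG M hi) (UPG M lo) (Lflat k L a) (eflat k e)
        (MvPolynomial.rename (Fin.castAdd k) p) (pad k ℓ₁) n₁ hmem
        (fun w hw => by rw [hr₀i w hw]; simp [intP]) hr₀b
    · exact absurd rfl hn1
    · obtain rfl : n₁ = 0 := by omega
      exact flat_pole r₀ (ZRG M lo hi) (LWG M hi) (UPG M lo) (Lflat k L a) (eflat k e)
        (MvPolynomial.rename (Fin.castAdd k) p) (pad k ℓ₂) n' hmem
        (fun w hw => by rw [hr₀i w hw]; simp [intG]) hr₀b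
  obtain ⟨c, hc, hrel⟩ := key
  refine ⟨c, AddSubgroup.closure_mono hsub hc, ?_⟩
  have : KZ.of s - c = (KZ.of s - KZ.of r₀) + (KZ.of r₀ - c) := by abel
  rw [this]
  exact KZ.relations.add_mem h₀ hrel

end Summit.KontsevichZagierPeriods.ArrangementNormalForm.JanusBands
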